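import Summits.Langlands.Langlands.Theses.AbelianSurfaceSerre
import Summits.Langlands.Langlands.Theorems.AbelianSurfaceSerreSerreGSp4SurjectiveSingerDefs
import Summits.Langlands.Langlands.Theorems.AbelianSurfaceSerreSerreGSp4SurjectiveStubAutomorphyLifting
import Literature.NumberTheory.GaloisRepresentations.CompatibleSystemResidualIrreducibility

/-!
# Strategy census r1 (redirect strategist, second opinion) — typed appendix
# crux `SerreGSp4Surjective` (stmt-Langlands-17765), route-Langlands-AbelianSurfaceSerre

Companion of `STRATEGY-CENSUS-r1.md` (same directory).  Nothing here is a route item or a stub of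
a line; these are the TYPED TARGETS the census argues about, plus the small machine checks it
quotes.  `lean check` rc 0, no `sorry`.

* §1 `KStarAt / KStar` — the true open kernel every line and split of this crux reduces to:
  coefficient-blind, level-tolerant Serre for `GSp₄/ℚ` in ONE Fontaine–Laffaille weight at an
  unbounded set of primes (lead a1's `stub_anchorPrime`, lead c1's `FLFontaineMazur` in its
  RESIDUAL and SYMPLECTIC form — strictly weaker than c1's non-self-dual `GL₄` statement).
* §2 `FMCS` — the same kernel in compatible-system language (Fontaine–Mazur–Langlands for regular
  odd-symplectic rank-4 weakly compatible systems over `ℚ`), the cleanest "strengthen" target; the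
  census explains why it is the same wall (no residual-automorphy source at any prime ≥ 5).
* §3 `LevelOneCase` — the conductor-one special case of the crux (the only regime where structural
  accidents exist: Fontaine–Abrashkin voids at 5, 7), with the trivial implication from the crux
  (a RUNG candidate, itself open: census N10).
* §4 machine checks quoted in the census: the Bertrand window `(3p/4 + 2, p)` used by the
  level-one weight reduction is EMPTY exactly for `p ∈ {5,7,11,13,17,23,29}` among `p < 37`
  (beyond 37 Nagura's theorem applies); the arc lemma "four residues mod `m` fit in an arc of
  length `m - ⌈m/4⌉` after a rotation" checked by `decide` at `m = 6, 8` with the tight example;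
  the dimension nail `(p² - 1)/2 > 4` for `p ≥ 5` (no 4-dimensional Artin lift of `Sp₄(𝔽_p)`).
* §5 (comments only) the kernel probe of the crux against the summit run 2026-08-17 (BC7 tool):
  `VERDICT: CLEAN`; P5 `C → S` failed 7/7 tactics, `S → C` failed 6/6 — the crux is neither
  cheaply the summit nor cheaply implied by it (tribunal T1 (b) does not fire in the kernel).
-/

set_option linter.dupNamespace false

namespace Summit.Langlands.Langlands.Cruxes.SerreGSp4Surjective.StrategistR1

open Literature.NumberTheory.GaloisRepresentations Literature.NumberTheory.Automorphic
  Literature.NumberTheory.PAdicHodge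
open Summit.Langlands.Langlands.Cruxes.SerreGSp4Surjective.SingerTypeEvaporation
open scoped NumberField
open IsDedekindDomain Filter

noncomputable section

/-! ## §1 The kernel `K*` -/

/-- **`K*` at the prime `ℓ`** (coefficient-blind, level-tolerant Serre for `GSp₄/ℚ` in one
Fontaine–Laffaille weight): for every regular multiset `wts` of four integers in an interval of
length `≤ ℓ - 2`, every finite field `k` of characteristic `ℓ` and every `ρ' : Γ_ℚ → GL₄(k)`
irreducible on `Γ_{ℚ(ζ_ℓ)}` which is the reduction, along some residue map, of an `ℓ`-adic `r'`
that is symplectic with multiplier EXACTLY `ε_ℓ⁻¹`, unramified almost everywhere and crystalline at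
`ℓ` with labelled weights `wts` (ANY conductor away from `ℓ`), `ρ'` is residually automorphic in the
sense consumed by BLGGT Thm 4.2.1 (`ResiduallyAutomorphic`, landed vocabulary).  This is lead a1's
`stub_anchorPrime` made line-independent and lead c1's `FLFontaineMazur` with the self-duality and
the residual form restored (c1 dropped self-duality; for non-self-dual `GL₄/ℚ` even automorphy
LIFTING is unknown, so the symplectic residual form is the right kernel to name).
[cite: BarnetlambEtAl2014, Thm 4.2.1] [cite: HerzigTilouine2013, Conj. 1 (context)] -/
def KStarAt (ℓ : ℕ) [Fact ℓ.Prime] : Prop :=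
  ∀ (wts : Multiset ℤ) (lo hi : ℤ), wts.Nodup → Multiset.card wts = 4 →
    (∀ x ∈ wts, lo ≤ x ∧ x ≤ hi) → hi - lo + 2 ≤ (ℓ : ℤ) →
  ∀ (k : Type) [Field k] [Fintype k] [CharP k ℓ] [TopologicalSpace k] [DiscreteTopology k]
    (ρ' : FramedGaloisRep ℚ k 4),
    IrredOnCycKernel ℓ ρ' →
    (∃ (r' : FramedGaloisRep ℚ (PadicAlgCl ℓ) 4)
        (red : (Valued.v : Valuation (PadicAlgCl ℓ) NNReal).valuationSubring →+* AlgebraicClosure k),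
        r'.IsSymplecticWithMultiplierFun (cycInv ℓ) ∧
        (∀ᶠ v : HeightOneSpectrum (𝓞 ℚ) in Filter.cofinite, r'.IsUnramifiedAt v) ∧
        IsCrystallineWithWeightsAt ℓ wts r' ∧ ReducesAlong ℓ red r' ρ') →
    ResiduallyAutomorphic ℓ ρ'

/-- **`K*`**: `KStarAt ℓ` for an unbounded set of primes `ℓ` (all the singer composition needs: the
family's good set is unbounded, so one anchor prime beyond any bound suffices). [folklore] -/
def KStar : Prop :=
  ∀ N : ℕ, ∃ (ℓ : ℕ) (hℓ : ℓ.Prime), N ≤ ℓ ∧ @KStarAt ℓ ⟨hℓ⟩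

/-! ## §2 The compatible-system form `FMCS` -/

/-- **Fontaine–Mazur–Langlands for regular odd-symplectic rank-4 compatible systems over `ℚ`**:
every REGULAR (`H.Nodup`) weakly compatible system of rank 4 (landed predicate
`IsWeaklyCompatibleSystemRat`, BLGGT §5.1) all of whose members are irreducible and symplectic with
multiplier an ODD power of `ε⁻¹` is automorphic member by member (`AutomorphicAE`).  No residual
hypothesis: for such systems residual irreducibility on `Γ_{ℚ(ζ_ℓ)}` holds on a set of density one
(landed `BLGGT2014_prop532_residuallyIrreducible_densityOne`), so `FMCS` and `K*` are the same
wall seen from the two sides (census §Strengthen).  The rank-2 weight-`{0,1}` analogue is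
"modularity of `GL₂`-type compatible systems over `ℚ`" = Serre (Khare–Wintenberger) ∘ Ribet.
[cite: FontaineMazurGeometric1995, Conj. 1] [cite: BarnetlambEtAl2014, §5.1] -/
def FMCS : Prop :=
  ∀ (S : Finset (HeightOneSpectrum (𝓞 ℚ))) (Q : HeightOneSpectrum (𝓞 ℚ) → Polynomial ℂ)
    (H : Multiset ℤ)
    (𝓡 : ∀ (ℓ : ℕ) [Fact ℓ.Prime], (PadicAlgCl ℓ ≃+* ℂ) → FramedGaloisRep ℚ (PadicAlgCl ℓ) 4),
    IsWeaklyCompatibleSystemRat 4 S Q H 𝓡 → H.Nodup →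
    (∀ (ℓ : ℕ) [Fact ℓ.Prime] (ι : PadicAlgCl ℓ ≃+* ℂ),
      (𝓡 ℓ ι).toGaloisRep.IsIrreducible ∧
        ∃ w : ℕ, Odd w ∧ (𝓡 ℓ ι).IsSymplecticWithMultiplierFun (fun g => cycInv ℓ g ^ w)) →
    ∀ (ℓ : ℕ) [Fact ℓ.Prime] (ι : PadicAlgCl ℓ ≃+* ℂ), AutomorphicAE ℓ (𝓡 ℓ ι)

/-! ## §3 The conductor-one special case (rung candidate; open) -/

/-- **Level-one case of the crux**: the crux restricted to `ρ̄` unramified away from `p`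
(conductor 1).  The only regime with STRUCTURAL small-prime accidents (Fontaine–Abrashkin voids at
5, 7 in weights `⊂ [0,3]`); Khare's level-one architecture transfers as far as weight reduction
(twist into an arc of length `≤ 3(p-1)/4`, then a prime in `(3p/4+2, p)`, §4) and stops at
Skinner–Wiles-at-level-one and at the base primes `p ≤ 29` (census N10). [cite: Khare2006, Thm. 1.1]
-/
def LevelOneCase : Prop :=
  ∃ p₀ : ℕ, ∀ (p : ℕ) [Fact p.Prime], p₀ ≤ p → ∀ ρ : FramedGaloisRep ℚ (ZMod p) 4,
    FullSymplecticImage p ρ → OrdinaryDistinguishedAt p ρ →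
    (∀ v : HeightOneSpectrum (𝓞 ℚ), ((p : ℕ) : 𝓞 ℚ) ∉ v.asIdeal → ρ.IsUnramifiedAt v) →
    RegularOrdinaryModular p ρ

/-- The level-one case is a special case of the crux (the rung direction; the converse is the
whole difficulty of level raising and is not claimed). [folklore] -/
theorem levelOneCase_of_crux
    (h : Summit.Langlands.Langlands.Theses.AbelianSurfaceSerre.SerreGSp4Surjective) :
    LevelOneCase := by
  obtain ⟨p₀, h⟩ := serreGSp4Surjective_iff.mp h
  exact ⟨p₀, fun p _ hp ρ h1 h2 _ => h p hp ρ h1 h2⟩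

/-! ## §4 Machine checks quoted in the census -/

/-- Bertrand window for the level-one weight reduction: among primes `p < 37` the open interval
`(3p/4 + 2, p)` contains NO prime exactly for `p ∈ {5,7,11,13,17,23,29}` — stated without
`Nat.Prime`: every integer `q` with `3p + 8 < 4q < 4p` has a proper divisor. (For `p = 19, 31`
the primes `17, 29` lie in the window; for `p ≥ 37` Nagura's theorem — a prime in `(n, 6n/5)` for
`n ≥ 25` — gives one.) [folklore] -/
theorem bertrandWindow_empty_small :
    ∀ p ∈ ({5, 7, 11, 13, 17, 23, 29} : Finset ℕ),
      ∀ q ∈ Finset.range p, 3 * p + 8 < 4 * q → ∃ d ∈ Finset.range q, 1 < d ∧ q % d = 0 := by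
  decide

/-- … and the window is inhabited by a prime for `p = 19` (`q = 17`) and `p = 31` (`q = 29`).
[folklore] -/
theorem bertrandWindow_witness_19_31 :
    (3 * 19 + 8 < 4 * 17 ∧ 17 < 19 ∧ Nat.Prime 17) ∧ (3 * 31 + 8 < 4 * 29 ∧ 29 < 31 ∧ Nat.Prime 29) := by
  refine ⟨⟨by norm_num, by norm_num, by norm_num⟩, ⟨by norm_num, by norm_num, by norm_num⟩⟩

set_option maxRecDepth 200000 in
/-- Arc lemma, instance `m = 6` (`⌈6/4⌉ = 2`): any four residues mod 6 fit, after a rotation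
moving one of them to `0`, in `[0, 4]`. (General statement: four points on `ℤ/m` leave a gap
`≥ ⌈m/4⌉`, so a rotation puts them in an arc of length `m - ⌈m/4⌉`; applied with `m = p - 1` to
the four inertial exponents of an ordinary `ρ̄|I_p`, twisting by `ω^t`.) [folklore] -/
theorem arc_mod_six : ∀ f : Fin 4 → ZMod 6, ∃ j : Fin 4, ∀ i : Fin 4, (f i - f j).val ≤ 4 := by
  decide

set_option maxRecDepth 200000 in
/-- Arc lemma, instance `m = 8` (`⌈8/4⌉ = 2`, arc `[0, 6]`), and tightness: the configuration
`(0,2,4,6)` has spread exactly `6` under every rotation to a member. [folklore] -/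
theorem arc_mod_eight :
    (∀ f : Fin 4 → ZMod 8, ∃ j : Fin 4, ∀ i : Fin 4, (f i - f j).val ≤ 6) ∧
      ∀ j : Fin 4, ∃ i : Fin 4, ((![0, 2, 4, 6] : Fin 4 → ZMod 8) i - (![0, 2, 4, 6] : Fin 4 → ZMod 8) j).val = 6 := by
  constructor
  · decide
  · decide

/-- Dimension nail for "no Langlands–Tunnell prime" (census N2): the minimal degree `(p² - 1)/2`
of a faithful complex representation of `Sp₄(𝔽_p)` (Landazuri–Seitz) exceeds `4` for every
`p ≥ 5`, so the natural 4-dimensional `ρ̄` has no Artin lift through `GSp₄(𝔽_p) ↪ GL₄(ℂ)`.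
[cite: LandazuriSeitz1974, Table 1] -/
theorem minFaithfulDegree_gt_four (p : ℕ) (hp : 5 ≤ p) : 4 < (p ^ 2 - 1) / 2 := by
  have h25 : 25 ≤ p ^ 2 := by nlinarith
  omega

/-! ## §5 Kernel probe of the crux against the summit (BC7 tool, run 2026-08-17 by this seat)

```
#h21_crux_probe …AbelianSurfaceSerre.SerreGSp4Surjective route := "route-Langlands-AbelianSurfaceSerre"
shape: ∀×0 H×0 ⊢ exists;  P1 ok (10 attempts failed incl. exact?);  P5 ok: C→S failed 7/7, S→C failed 6/6
VERDICT: CLEAN   (file bc/K1_probe.lean in the seat folder; lean check rc 0)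
```
So neither `SerreGSp4Surjective → Langlands` nor `Langlands → SerreGSp4Surjective` is visible to the
kernel; mathematically `S ⇒ C` needs the Hodge–Tate-cocharacter bullet omitted from `S` (AUDIT) and
the printed existence of crystalline-ordinary lifts (Fakhruddin–Khare–Patrikis), and `C ⇒ S` is not
certified (four other open binders in `closes`).  Tribunal placement: T1 (a)–(d) do not fire; the
crux is strictly BELOW the summit — a frontier open problem (Serre for `GSp₄/ℚ`), census §Placement.
-/

end

end Summit.Langlands.Langlands.Cruxes.SerreGSp4Surjective.StrategistR1
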